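import Mathlib.Analysis.SpecialFunctions.Exp
import Mathlib.Analysis.Complex.Basic
import Mathlib.Algebra.Polynomial.Roots
import Mathlib.Algebra.Polynomial.Splits
import Mathlib.Topology.Algebra.InfiniteSum.Basic
import HarnessLib

/-!
# Hutchinson's theorem and the Gaussian complex-zero-decreasing sequence (Laguerre–Pólya)

Topic `Literature/Analysis/Complex`. Two NAMED FACTS (D-0014, statements only), both quoted from
the held text of T. H. Nguyen, A. Vishnyakova, *On a necessary condition for an entire function with
the increasing second quotients of Taylor coefficients to belong to the Laguerre–Pólya class*,
J. Math. Anal. Appl. 480 (2019) 123433 = arXiv:1903.09070, p. 3 (Theorems B and C and the display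
following Theorem C), where they are attributed to Hutchinson (1923) and to Laguerre–Pólya:

* `Hutchinson1923_thmB` — **Hutchinson's theorem** (NV2019 Thm. B; Hutchinson, Trans. AMS 25
  (1923) 325–332): for an entire `f(z) = Σ_{k≥0} a_k z^k` with `a_k > 0` for all `k`,
  `q_n(f) := a_{n-1}² / (a_{n-2} a_n) ≥ 4` for all `n ≥ 2` iff (i) the zeros of `f` are all real,
  simple and negative, and (ii) the zeros of every polynomial `Σ_{k=m}^{n} a_k z^k` of consecutive
  terms are real and non-positive. We vendor the forward implication to (i) WITHOUT simplicity
  (weaker than print): `q_n ≥ 4 ∀ n ≥ 2 ⇒` every zero of `f` is real and negative.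
* `PolyaLaguerre_gaussian_CZDS` — **the Gaussian sequence is complex-zero-decreasing** (NV2019
  Thm. C, G. Pólya after Laguerre: for `φ ∈ L-P` with only negative zeros `(φ(k))_k ∈ CZDS`, and
  the displayed consequence `(a^{-k²})_{k≥0} ∈ CZDS` for `a ≥ 1`): for every real polynomial
  `P = Σ b_k z^k`, the polynomial `Σ a^{-k²} b_k z^k` has no more non-real zeros (counted with
  multiplicity, NV2019 Def. 2: `Z_c`) than `P`.

plus the proved corollary `PolyaLaguerre_gaussian_CZDS.splits` — the multiplier-sequence form
used by route `RiemannHypothesis/AngularHeatFlow` (items `AhfMonotone`, `AhfConverse`): if `P`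
has only real zeros then so does `Σ e^{-c k²} b_k z^k` for every `c ≥ 0` (`a = e^c ≥ 1`).

## Typing notes

* `Z_c(P)`, the number of non-real zeros of a real polynomial counted with multiplicity, is
  `nonrealRootCount P := P.natDegree - P.roots.card` (`P.roots` = the multiset of REAL roots with
  multiplicity; a nonzero real polynomial of degree `d` has `d` complex roots; for `P = 0` both
  sides are `0`). [NV2019 Def. 2]
* The Gaussian twist is `gaussTwist a P := Σ_{k ≤ deg P} C((a^{k²})⁻¹ · b_k) X^k` (ℕ-powers, no
  `rpow`); for `a = e^c` the weight is `e^{-c k²}`.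
* In `Hutchinson1923_thmB` the function is given by its coefficient sequence; "entire" is kept as
  the hypothesis that the series is summable at every `z` (it follows from `q_n ≥ 4`, but we state
  it as printed: "Let `f` be an entire function with positive coefficients").

## Use

`Hutchinson1923_thmB` grounds `…AngularHeatFlow.AhfRungZero` (with `a_k = e^{-ck²}·xiSqCoeff k`,
`c ≥ log 2`, and log-concavity of `xiSqCoeff`); `PolyaLaguerre_gaussian_CZDS` grounds
`…AngularHeatFlow.AhfMonotone` / `AhfConverse` (polynomial level; the passage to the entire
`T_c G` is Laguerre–Pólya approximation + Hurwitz, prover-side). Users take `(h : <FactName>)`.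

## References

* J. I. Hutchinson, *On a remarkable class of entire functions*, Trans. Amer. Math. Soc. 25 (1923)
  325–332, doi:10.2307/1989293 [Hutchinson1923].
* T. H. Nguyen, A. Vishnyakova, JMAA 480 (2019) 123433, arXiv:1903.09070, p. 3, Thms. B, C
  [NguyenVishnyakova2019].
-/

noncomputable section

namespace Literature.Analysis.Complex

open Polynomial

/-- `Z_c(P)`: the number of non-real zeros of a real polynomial `P`, counted with multiplicity —
`deg P` minus the number of real roots with multiplicity (`0` for `P = 0`).
[cite: NguyenVishnyakova2019, p. 3 Def. 2 (Z_c)] -/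
def nonrealRootCount (P : ℝ[X]) : ℕ :=
  P.natDegree - P.roots.card

/-- The Gaussian twist `Σ_k a^{-k²} b_k X^k` of `P = Σ_k b_k X^k`.
[cite: NguyenVishnyakova2019, p. 3, display following Thm. C ((a^{-k²}) ∈ CZDS)] -/
def gaussTwist (a : ℝ) (P : ℝ[X]) : ℝ[X] :=
  ∑ k ∈ Finset.range (P.natDegree + 1), C ((a ^ (k ^ 2))⁻¹ * P.coeff k) * X ^ k

/-- **Hutchinson's theorem (1923), forward direction, as quoted in Nguyen–Vishnyakova 2019,
Thm. B:** let `f(z) = Σ_{k≥0} a_k z^k` be entire with `a_k > 0` for all `k`; if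
`a_{n-1}² ≥ 4 a_{n-2} a_n` for all `n ≥ 2`, then all zeros of `f` are real (simple) and negative.
Simplicity is omitted here. Grounds
`Summit.RiemannHypothesis.RiemannHypothesis.Theses.AngularHeatFlow.AhfRungZero`.
[cite: Hutchinson1923, main theorem (Trans. AMS 25, pp. 325–332)] [cite: NguyenVishnyakova2019, p. 3 Thm. B] -/
def Hutchinson1923_thmB : Prop :=
  ∀ (a : ℕ → ℝ), (∀ k, 0 < a k) →
    (∀ n : ℕ, 2 ≤ n → 4 * (a (n - 2) * a n) ≤ a (n - 1) ^ 2) →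
    (∀ z : ℂ, Summable fun k : ℕ => (a k : ℂ) * z ^ k) →
    ∀ z : ℂ, (∑' k : ℕ, (a k : ℂ) * z ^ k) = 0 → z.im = 0 ∧ z.re < 0

/-- **The Gaussian sequence `(a^{-k²})_{k ≥ 0}`, `a ≥ 1`, is a complex zero decreasing sequence**
(Laguerre; G. Pólya: `(φ(k))_k ∈ CZDS` for `φ ∈ L-P` with only negative zeros — as quoted in
Nguyen–Vishnyakova 2019, Thm. C and the display following it): for every real polynomial `P`,
`Z_c(Σ a^{-k²} b_k z^k) ≤ Z_c(P)`. Grounds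
`Summit.RiemannHypothesis.RiemannHypothesis.Theses.AngularHeatFlow.AhfMonotone` and `.AhfConverse`
at the polynomial level.
[cite: NguyenVishnyakova2019, p. 3 Thm. C and following display] -/
def PolyaLaguerre_gaussian_CZDS : Prop :=
  ∀ a : ℝ, 1 ≤ a → ∀ P : ℝ[X], nonrealRootCount (gaussTwist a P) ≤ nonrealRootCount P

/-! ## Elementary consequences (proved) -/

/-- `Z_c(P) = 0` iff `P` splits over `ℝ` (all roots real), for `P ≠ 0` and trivially for `P = 0`.
[folklore] -/
theorem nonrealRootCount_eq_zero_iff (P : ℝ[X]) : nonrealRootCount P = 0 ↔ P.Splits := by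
  unfold nonrealRootCount
  rw [Nat.sub_eq_zero_iff_le, splits_iff_card_roots]
  constructor
  · exact fun h => le_antisymm (card_roots' P) h
  · exact fun h => h.ge

/-- **Multiplier-sequence form** (the case `Z_c(P) = 0`): for `c ≥ 0`, if the real polynomial
`P = Σ b_k X^k` has only real zeros then so does `Σ e^{-ck²} b_k X^k` (`= gaussTwist (e^c) P`,
since `((e^c)^{k²})⁻¹ = e^{-ck²}`). [cite: NguyenVishnyakova2019, p. 3 Thm. C and following display] -/
theorem PolyaLaguerre_gaussian_CZDS.splits (h : PolyaLaguerre_gaussian_CZDS) {c : ℝ} (hc : 0 ≤ c)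
    {P : ℝ[X]} (hP : P.Splits) : (gaussTwist (Real.exp c) P).Splits := by
  have ha : 1 ≤ Real.exp c := Real.one_le_exp hc
  have h0 : nonrealRootCount P = 0 := (nonrealRootCount_eq_zero_iff P).2 hP
  have h1 : nonrealRootCount (gaussTwist (Real.exp c) P) = 0 :=
    Nat.le_zero.1 (h0 ▸ h (Real.exp c) ha P)
  exact (nonrealRootCount_eq_zero_iff _).1 h1

/-- The weights of `gaussTwist (e^c)` are the Gaussian `e^{-ck²}`. [folklore] -/
theorem inv_exp_pow_sq (c : ℝ) (k : ℕ) :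
    ((Real.exp c) ^ (k ^ 2))⁻¹ = Real.exp (-(c * (k : ℝ) ^ 2)) := by
  rw [← Real.exp_nat_mul, ← Real.exp_neg]
  congr 1
  push_cast
  ring

end Literature.Analysis.Complex

end
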